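import Literature.NumberTheory.EllipticCurves.Kato2004.LocalIwasawaCohomologyPoitouTate

/-!
# Cert49e — crux-triage round 1, seat 2/2 (independent), GEN 49 ADDENDUM-1: PRE-VET of the LEAD g10's announced v24 step (i)

Crux `OrdKatoHalfAtTwoIso` (item stmt-BirchSwinnertonDyer-19573), line `steinberg-fibre-at-two`, skeleton of record v23
`33b5bb88c81a3cfe…` (9 stubs).  The LEAD (cruxlead-19573 g10, STATUS 15:51Z) announces v24 step (i): the cite stub
`stub_tateDualityTower` (registered TYPE = the Literature fact p723619
`Kato2004.exists_lambdaAdicLocalTatePairing_selmer_orthogonal` BY NAME) is to be re-cited as the STRONGER fact p729889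
`Kato2004.exists_lambdaAdicLocalTatePairing_poitouTate_exact` (w3 g6, accepted 15:44Z: the same six clauses (K)(T)(C)(S)(I)(R)
VERBATIM plus (E) Poitou–Tate exactness).  This file checks in the kernel, BY NAME and over tree modules only, that the new citation
DISCHARGES the registered one: the seven-clause fact projects onto the six-clause fact.  Hence, if v24 registers S1 ↦ p729889 and keeps
the other eight registered types, joint sufficiency of the v24 tuple follows from `Cert49.ordKatoHalfAtTwoIso_of_recutB` (crux commit
784210c500bc) composed with `s1_of_poitouTate_exact` — nothing else to re-read for step (i).  (Step (ii) — {V♭⁺, Q⁺} ↦ one Greenberg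
LNM 1716 Conj. 1.11-at-2 stub — cannot be pre-vetted before w3's consumer and the stub text exist; armed conditions in TRIAGE-r1-2.md ADD-1.)

HONEST STATUS: a one-line projection between two `def … : Prop` Literature facts (both declared debt, PRINT-COMPOSITE readings; neither is
asserted here).  Nothing is proved about any curve; BSD is not proved; crux 19573 and its children 24097 / 23921 / 23889 stay OPEN.
-/

set_option autoImplicit false
set_option linter.dupNamespace false

open scoped NumberField
open Field IsDedekindDomain WeierstrassCurve
open Literature.NumberTheory.GaloisRepresentations
open Literature.NumberTheory.EllipticCurves Literature.NumberTheory.EllipticCurves.GreenbergSelmer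
open Literature.NumberTheory.EllipticCurves.Kato2004 Literature.NumberTheory.EllipticCurves.Kato2004.EulerSystemValues

namespace Summit.BirchSwinnertonDyer.BirchSwinnertonDyer.Cruxes.OrdKatoHalfAtTwoIso.Cert49e

/-- v24 step (i) discharges v23's registered `stub_tateDualityTower`: the seven-clause Poitou–Tate-exact fact (p729889) projects onto the
six-clause Selmer-orthogonality fact (p723619) — same binders, drop clause (E). -/
theorem s1_of_poitouTate_exact
    (h : exists_lambdaAdicLocalTatePairing_poitouTate_exact) :
    exists_lambdaAdicLocalTatePairing_selmer_orthogonal := by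
  intro p _ W _ _ _ _ _ κ γ hκ hγ hord v hv γᵥ hsurj hγᵥ I J J'
  obtain ⟨toDualP, hK, hT, hC, hS, hI, hR, -⟩ := h p W κ γ hκ hγ hord v hv γᵥ hsurj hγᵥ I J J'
  exact ⟨toDualP, hK, hT, hC, hS, hI, hR⟩

/-- The converse direction is NOT claimed: clause (E) is extra content (Poitou–Tate exactness), not a consequence of (K)–(R).  Recorded
only so that a reader does not mistake the two facts for equivalent: the registered v23 text is the WEAKER one. -/
theorem poitouTate_exact_clauseE_statement :
    exists_lambdaAdicLocalTatePairing_poitouTate_exact →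
      ∀ (p : ℕ) [Fact p.Prime] (W : WeierstrassCurve ℚ) [W.IsElliptic] [W.IsGloballyMinimal]
        [ContinuousSMul ℤ_[p] (W.tateModule p)] [Module.Free ℤ_[p] (W.tateModule p)] [Module.Finite ℤ_[p] (W.tateModule p)]
        (κ : ZpExtension ℚ p) (γ : absoluteGaloisGroup ℚ) (_hκ : κ.IsCyclotomic) (hγ : κ.IsTopGenerator γ),
        IsOrdinaryAt W p →
        ∀ (v : HeightOneSpectrum (𝓞 ℚ)) (_ : ((p : ℕ) : 𝓞 ℚ) ∈ v.asIdeal)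
          (γᵥ : absoluteGaloisGroup (v.adicCompletion ℚ))
          (hsurj : Function.Surjective
            (κ.toContinuousMonoidHom.comp (resGalOfEmb (closureEmb (K := ℚ) (v.adicCompletion ℚ)))))
          (hγᵥ : κ.IsTopGenerator (resGalOfEmb (closureEmb (K := ℚ) (v.adicCompletion ℚ)) γᵥ))
          (I : IwasawaH1Data W p κ γ) (J : LocalIwasawaH1Data κ v ((tateRep W p).toLocal v) γᵥ)
          (J' : LocalIwasawaH1Data κ v (tateLocalOrdinaryRep W p v) γᵥ),
        ∃ toDualP : J.H →+ (W.subgroupH1 p κ.kerSubgroup →+ AddCircle (1 : ℚ)),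
          (∀ (g : I.H) (s : W.selmerInfty κ), toDualP (I.loc J hsurj hγ hγᵥ g) s = 0) ∧
          (∀ x : J.H, (∀ s : W.selmerInfty κ, toDualP x s = 0) →
            ∃ (y : J'.H) (g : I.H), x = J'.ordinaryInclusion J y + I.loc J hsurj hγ hγᵥ g) := by
  intro h p _ W _ _ _ _ _ κ γ hκ hγ hord v hv γᵥ hsurj hγᵥ I J J'
  obtain ⟨toDualP, -, -, -, -, -, hR, hE⟩ := h p W κ γ hκ hγ hord v hv γᵥ hsurj hγᵥ I J J'
  exact ⟨toDualP, hR, hE⟩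

end Summit.BirchSwinnertonDyer.BirchSwinnertonDyer.Cruxes.OrdKatoHalfAtTwoIso.Cert49e
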